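import Literature.NumberTheory.LFunctions.MoebiusWalshTypeIIHighBox
import Literature.NumberTheory.LFunctions.MoebiusWalshAssembly
import HarnessLib

/-!
# Bourgain 2013, Theorem 1 for `μ` — discharge of `bourgain_moebius_walsh_uniform`

Topic `Literature/NumberTheory/LFunctions`, a proofs companion of `MoebiusWalshCircuits.lean`
(named fact `bourgain_moebius_walsh_uniform`: J. Bourgain, *Möbius–Walsh correlation bounds and an
estimate of Mauduit and Rivat*, J. Anal. Math. **119** (2013) 147–163 = arXiv:1109.2784
[Bourgain2013MoebiusWalsh], Theorem 1). Everything in this file is PROVED (theorems only; no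
definition, no named fact).

The tree holds the two halves of the printed proof of Theorem 1 for the Möbius function:

* the synthesis `MoebiusWalsh.bourgain_moebius_walsh_uniform_of_typeII`
  (`MoebiusWalshAssembly.lean`: Green's Proposition 1 for the small weights, the Vaughan-type
  reduction of [M-R] Lemma 1, the type-I estimates of §3, the box bookkeeping and the numerics of
  (3.10)), which takes as its only hypothesis a per-box TYPE-II estimate in the shape
  `|boxSum T i j α β| ≤ 2^{i+j}(i+j+2)^C (2^{-c g₀} + 2^{Cρ - c i} + 2^{Cρ - c|T ∩ [K, K+i+w)|})`,
  `w = ρ + g₀ + 1`, for `1`-bounded `α, β`, `T ⊆ [0, i+j+2)`, `1 ≤ g₀ ≤ ρ`, `Cρ ≤ i ≤ j` and an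
  admissible window origin `K` (`K = 0 ∨ i ≤ K + ρ`, and `K + w + 1 ≤ j` or
  `j + 2 ≤ K + w ∧ K + ρ ≤ j`);
* the per-box type-II estimate of §2 `MoebiusWalshTypeII.typeII_perBox`
  (`MoebiusWalshTypeIIHighBox.lean`, both digit windows `K = 0` and `K ≥ μ - ρ`), in the shape
  `∑_{a ∈ D_i} |∑_{b ∈ D_j} β(b) w_T(ab)| ≤ (i+j+2)^C 2^{i+j} (2^{-cρ} + 2^{Cρ - c i} + 2^{Cρ - c|T ∩ [K, K+i)|})`
  for `i ≤ j`, `1 ≤ ρ`, `K = 0 ∨ (i ≤ K + ρ ∧ 4ρ < K)`, `K + ρ ≤ j`, `|β| ≤ 1`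
  (it already discharged the Liouville twin, `bourgain_liouville_walsh_uniform_holds`).

This file supplies the elementary passage from the second shape to the first
(`MoebiusWalshTypeII.typeII_assemblyShape`) and concludes
**`Literature.NumberTheory.LFunctions.bourgain_moebius_walsh_uniform_holds`**:

* `|boxSum T i j α β| ≤ ∑_a |∑_b β(b) w_T(ab)|` for `|α| ≤ 1` (`abs_boxSum_le_sum_abs`);
* WINDOW COVERING (`exists_second_window`): for `T ⊆ [0, i+j+2)`, `8ρ ≤ i ≤ j`, `K + ρ ≤ j` and
  `K = 0 ∨ i ≤ K + ρ`, the long window `[K, K+i+w)` (`w ≤ 2ρ + 1`) is covered by the window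
  `[K, K+i)`, a second window `[K₂, K₂+i)` which is admissible for `typeII_perBox`
  (`K₂ = i - ρ` if `K = 0`, else `K₂ = min(K+i, j-ρ)`), and the top `ρ + 2` digit positions
  `[j-ρ+i, i+j+2)`; hence one of the two admissible windows carries at least
  `(|T ∩ [K, K+i+w)| - ρ - 2)/2` digits of `T` — this is the remark "varying `K`, the intervals
  `[K, K+μ+ρ]` will cover `[0, λ[`" of the paper, (2.30);
* the per-box estimate on the better window, and the exponent bookkeeping
  `c ↦ min(c,1)/2`, `C ↦ C + 7`.

## References

* J. Bourgain, *Möbius–Walsh correlation bounds and an estimate of Mauduit and Rivat*, J. Anal.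
  Math. 119 (2013) 147–163; arXiv:1109.2784: Theorem 1, §2 (2.29)–(2.31), §3 (3.10).
  [Bourgain2013MoebiusWalsh]
-/

noncomputable section

open Finset Real

namespace Literature.NumberTheory.LFunctions.MoebiusWalshTypeII

open Literature.NumberTheory.LFunctions.MoebiusWalshVaughan (natWalsh dyBlock boxSum abs_natWalsh)

/-! ### From the box sum to the sum of absolute values -/

/-- `|boxSum T i j α β| ≤ ∑_{a ∈ D_i} |∑_{b ∈ D_j} β(b) w_T(ab)|` for `|α| ≤ 1` (Bourgain 2013,
(2.1)). [cite: Bourgain2013MoebiusWalsh, (2.1)] -/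
theorem abs_boxSum_le_sum_abs (T : Finset ℕ) (i j : ℕ) (α β : ℕ → ℝ) (hα : ∀ a, |α a| ≤ 1) :
    |boxSum T i j α β| ≤ ∑ a ∈ dyBlock i, |∑ b ∈ dyBlock j, β b * natWalsh T (a * b)| := by
  unfold boxSum
  refine (Finset.abs_sum_le_sum_abs _ _).trans (Finset.sum_le_sum fun a _ => ?_)
  have h : ∑ b ∈ dyBlock j, α a * β b * natWalsh T (a * b) =
      α a * ∑ b ∈ dyBlock j, β b * natWalsh T (a * b) := by
    rw [Finset.mul_sum]
    exact Finset.sum_congr rfl fun b _ => by ring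
  rw [h, abs_mul]
  calc |α a| * |∑ b ∈ dyBlock j, β b * natWalsh T (a * b)|
      ≤ 1 * |∑ b ∈ dyBlock j, β b * natWalsh T (a * b)| :=
        mul_le_mul_of_nonneg_right (hα a) (abs_nonneg _)
    _ = _ := one_mul _

/-! ### Window covering -/

/-- **Window covering** (Bourgain 2013, (2.30): "varying `K`, the intervals `[K, K+μ+ρ]` will cover
`[0, λ[`"). Let `T ⊆ [0, i+j+2)`, `1 ≤ ρ`, `g₀ ≤ ρ`, `8ρ ≤ i ≤ j`, `K + ρ ≤ j`, and
`K = 0 ∨ i ≤ K + ρ`. Then there is a second window origin `K₂` with `i ≤ K₂ + ρ`, `4ρ < K₂`,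
`K₂ + ρ ≤ j` such that
`|T ∩ [K, K+i+ρ+g₀+1)| ≤ |T ∩ [K, K+i)| + |T ∩ [K₂, K₂+i)| + (ρ + 2)`
(`K₂ = i - ρ` if `K = 0`, `K₂ = min(K+i, j-ρ)` otherwise; the `ρ + 2` accounts for the top digit
positions `[j-ρ+i, i+j+2)`). [cite: Bourgain2013MoebiusWalsh, (2.30)] -/
theorem exists_second_window {T : Finset ℕ} {i j ρ g₀ K : ℕ} (hT : ∀ t ∈ T, t < i + j + 2)
    (hρ : 1 ≤ ρ) (hg₀ρ : g₀ ≤ ρ) (hi : 8 * ρ ≤ i) (hij : i ≤ j) (hK : K = 0 ∨ i ≤ K + ρ)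
    (hKρj : K + ρ ≤ j) :
    ∃ K₂ : ℕ, (i ≤ K₂ + ρ ∧ 4 * ρ < K₂) ∧ K₂ + ρ ≤ j ∧
      (T.filter fun t => K ≤ t ∧ t < K + i + (ρ + g₀ + 1)).card ≤
        (T.filter fun t => K ≤ t ∧ t < K + i).card +
          (T.filter fun t => K₂ ≤ t ∧ t < K₂ + i).card + (ρ + 2) := by
  classical
  -- the top digit positions
  have htop : (T.filter fun t => j - ρ + i ≤ t).card ≤ ρ + 2 := by
    calc (T.filter fun t => j - ρ + i ≤ t).card ≤ (Finset.Ico (j - ρ + i) (i + j + 2)).card := by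
          refine Finset.card_le_card fun t ht => ?_
          rw [Finset.mem_filter] at ht
          rw [Finset.mem_Ico]
          exact ⟨ht.2, hT t ht.1⟩
      _ = ρ + 2 := by rw [Nat.card_Ico]; omega
  -- covering by three pieces
  have key : ∀ K₂ : ℕ,
      (∀ t, K + i ≤ t → t < K + i + (ρ + g₀ + 1) → t < j - ρ + i → K₂ ≤ t ∧ t < K₂ + i) →
      (T.filter fun t => K ≤ t ∧ t < K + i + (ρ + g₀ + 1)).card ≤
        (T.filter fun t => K ≤ t ∧ t < K + i).card +
          (T.filter fun t => K₂ ≤ t ∧ t < K₂ + i).card + (ρ + 2) := by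
    intro K₂ hK₂
    calc (T.filter fun t => K ≤ t ∧ t < K + i + (ρ + g₀ + 1)).card
        ≤ ((T.filter fun t => K ≤ t ∧ t < K + i) ∪ (T.filter fun t => K₂ ≤ t ∧ t < K₂ + i) ∪
            (T.filter fun t => j - ρ + i ≤ t)).card := by
          refine Finset.card_le_card fun t ht => ?_
          simp only [Finset.mem_union, Finset.mem_filter] at ht ⊢
          obtain ⟨htT, hKt, htlt⟩ := ht
          by_cases h1 : t < K + i
          · exact Or.inl (Or.inl ⟨htT, hKt, h1⟩)
          · by_cases h2 : j - ρ + i ≤ t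
            · exact Or.inr ⟨htT, h2⟩
            · exact Or.inl (Or.inr ⟨htT, hK₂ t (not_lt.1 h1) htlt (not_le.1 h2)⟩)
      _ ≤ ((T.filter fun t => K ≤ t ∧ t < K + i) ∪ (T.filter fun t => K₂ ≤ t ∧ t < K₂ + i)).card +
            (T.filter fun t => j - ρ + i ≤ t).card := Finset.card_union_le _ _
      _ ≤ (T.filter fun t => K ≤ t ∧ t < K + i).card +
            (T.filter fun t => K₂ ≤ t ∧ t < K₂ + i).card + (ρ + 2) :=
          add_le_add (Finset.card_union_le _ _) htop
  rcases hK with hK0 | hKi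
  · subst hK0
    refine ⟨i - ρ, ⟨by omega, by omega⟩, by omega, key (i - ρ) ?_⟩
    intro t h1 h2 h3
    constructor <;> omega
  · rcases le_total (K + i) (j - ρ) with hle | hle
    · refine ⟨K + i, ⟨by omega, by omega⟩, by omega, key (K + i) ?_⟩
      intro t h1 h2 h3
      constructor <;> omega
    · refine ⟨j - ρ, ⟨by omega, by omega⟩, by omega, key (j - ρ) ?_⟩
      intro t h1 h2 h3
      constructor <;> omega

/-! ### The type-II estimate in the shape consumed by the assembly -/

/-- **The per-box type-II estimate of Bourgain 2013, §2, in the shape of the hypothesis of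
`MoebiusWalsh.bourgain_moebius_walsh_uniform_of_typeII`.** There are `c > 0`, `C ≥ 0` such that for
`i ≤ j`, `1 ≤ g₀ ≤ ρ`, `Cρ ≤ i`, `T ⊆ [0, i+j+2)`, `K = 0 ∨ i ≤ K + ρ`,
`K + (ρ+g₀+1) + 1 ≤ j ∨ (j + 2 ≤ K + (ρ+g₀+1) ∧ K + ρ ≤ j)`, `|α|, |β| ≤ 1`:

  `|boxSum T i j α β| ≤ 2^{i+j} (i+j+2)^C (2^{-c g₀} + 2^{Cρ - c i} + 2^{Cρ - c |T ∩ [K, K+i+ρ+g₀+1)|})`.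

From `typeII_perBox` (constants `c₀, C₀`) with `c = min(c₀,1)/2`, `C = C₀ + 7`: the box sum is at
most `∑_a |∑_b β(b) w_T(ab)|`, the long window is covered by two admissible windows and `ρ + 2`
top positions (`exists_second_window`), and `typeII_perBox` is applied on the denser of the two.
[cite: Bourgain2013MoebiusWalsh, §2 (2.29)–(2.31)] -/
theorem typeII_assemblyShape : ∃ c : ℝ, 0 < c ∧ ∃ C : ℝ, 0 ≤ C ∧
    ∀ (i j ρ g₀ K : ℕ) (T : Finset ℕ) (α β : ℕ → ℝ),
      i ≤ j → 1 ≤ g₀ → g₀ ≤ ρ → C * ρ ≤ i →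
      (∀ t ∈ T, t < i + j + 2) →
      (K = 0 ∨ i ≤ K + ρ) →
      (K + (ρ + g₀ + 1) + 1 ≤ j ∨ (j + 2 ≤ K + (ρ + g₀ + 1) ∧ K + ρ ≤ j)) →
      (∀ a, |α a| ≤ 1) → (∀ b, |β b| ≤ 1) →
      |boxSum T i j α β| ≤ 2 ^ (i + j) * ((i : ℝ) + j + 2) ^ C *
        ((2 : ℝ) ^ (-(c * g₀)) + (2 : ℝ) ^ (C * ρ - c * i) +
          (2 : ℝ) ^ (C * ρ - c *
            ((T.filter (fun t => K ≤ t ∧ t < K + i + (ρ + g₀ + 1))).card : ℝ))) := by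
  classical
  obtain ⟨c, hc, C, hC1, hPB⟩ := typeII_perBox
  set c₁ : ℝ := min c 1 with hc₁def
  have hc₁c : c₁ ≤ c := min_le_left _ _
  have hc₁1 : c₁ ≤ 1 := min_le_right _ _
  have hc₁0 : 0 < c₁ := lt_min hc one_pos
  refine ⟨c₁ / 2, by positivity, C + 7, by linarith, ?_⟩
  intro i j ρ g₀ K T α β hij hg₀ hg₀ρ hCi hT hK hKj hα hβ
  have hρ1 : 1 ≤ ρ := hg₀.trans hg₀ρ
  have hi8 : 8 * ρ ≤ i := by
    have hρ0 : (0 : ℝ) ≤ ρ := Nat.cast_nonneg ρ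
    have h : (8 : ℝ) * ρ ≤ (C + 7) * ρ := by nlinarith
    exact_mod_cast h.trans hCi
  have hKρj : K + ρ ≤ j := by omega
  have hKadm : K = 0 ∨ (i ≤ K + ρ ∧ 4 * ρ < K) := by
    by_cases h0 : K = 0
    · exact Or.inl h0
    · rcases hK with h | h
      · exact absurd h h0
      · exact Or.inr ⟨h, by omega⟩
  obtain ⟨K₂, hK₂adm, hK₂j, hcard⟩ := exists_second_window hT hρ1 hg₀ρ hi8 hij hK hKρj
  -- notation
  set P : ℝ := (i : ℝ) + j + 2 with hPdef
  set W₁ : ℕ := (T.filter fun t => K ≤ t ∧ t < K + i).card with hW₁def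
  set W₂ : ℕ := (T.filter fun t => K₂ ≤ t ∧ t < K₂ + i).card with hW₂def
  set W : ℕ := (T.filter fun t => K ≤ t ∧ t < K + i + (ρ + g₀ + 1)).card with hWdef
  -- the per-box estimate on the two windows
  have h1 := hPB T i j ρ K β hij hρ1 hKadm hKρj hβ
  have h2 := hPB T i j ρ K₂ β hij hρ1 (Or.inr hK₂adm) hK₂j hβ
  -- the denser window
  set m : ℕ := max W₁ W₂ with hmdef
  have hm1 : W₁ ≤ m := le_max_left _ _
  have hm2 : W₂ ≤ m := le_max_right _ _
  have hWm : W ≤ 2 * m + (ρ + 2) := by omega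
  have hbest : ∑ a ∈ dyBlock i, |∑ b ∈ dyBlock j, β b * natWalsh T (a * b)| ≤
      P ^ C * 2 ^ (i + j) *
        ((2 : ℝ) ^ (-(c * ρ)) + (2 : ℝ) ^ (C * ρ - c * i) + (2 : ℝ) ^ (C * ρ - c * (m : ℝ))) := by
    rcases le_total W₁ W₂ with h | h
    · rw [show m = W₂ from max_eq_right h]; exact h2
    · rw [show m = W₁ from max_eq_left h]; exact h1
  -- exponent bookkeeping
  have hρr : (1 : ℝ) ≤ ρ := by exact_mod_cast hρ1
  have hg₀r : (g₀ : ℝ) ≤ ρ := by exact_mod_cast hg₀ρ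
  have hg₀0 : (0 : ℝ) ≤ g₀ := Nat.cast_nonneg g₀
  have hWr : (W : ℝ) ≤ 2 * m + (ρ + 2) := by exact_mod_cast hWm
  have hm0 : (0 : ℝ) ≤ m := Nat.cast_nonneg m
  have hi0 : (0 : ℝ) ≤ i := Nat.cast_nonneg i
  have tA : (2 : ℝ) ^ (-(c * ρ)) ≤ (2 : ℝ) ^ (-(c₁ / 2 * g₀)) := by
    refine Real.rpow_le_rpow_of_exponent_le one_le_two ?_
    have e1 : c₁ * g₀ ≤ c * ρ := mul_le_mul hc₁c hg₀r hg₀0 hc.le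
    have e2 : c₁ / 2 * g₀ ≤ c₁ * g₀ := by nlinarith
    linarith
  have tB : (2 : ℝ) ^ (C * ρ - c * i) ≤ (2 : ℝ) ^ ((C + 7) * ρ - c₁ / 2 * i) := by
    refine Real.rpow_le_rpow_of_exponent_le one_le_two ?_
    have e1 : c₁ * i ≤ c * i := mul_le_mul_of_nonneg_right hc₁c hi0
    have e2 : c₁ / 2 * i ≤ c₁ * i := by nlinarith
    have e3 : (0 : ℝ) ≤ 7 * ρ := by positivity
    linarith
  have tC : (2 : ℝ) ^ (C * ρ - c * (m : ℝ)) ≤ (2 : ℝ) ^ ((C + 7) * ρ - c₁ / 2 * (W : ℝ)) := by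
    refine Real.rpow_le_rpow_of_exponent_le one_le_two ?_
    have e1 : c₁ * m ≤ c * m := mul_le_mul_of_nonneg_right hc₁c hm0
    have e2 : c₁ / 2 * (W : ℝ) ≤ c₁ / 2 * (2 * m + (ρ + 2)) :=
      mul_le_mul_of_nonneg_left hWr (by positivity)
    have e3 : c₁ / 2 * (2 * (m : ℝ) + (ρ + 2)) = c₁ * m + c₁ / 2 * (ρ + 2) := by ring
    have e4 : c₁ / 2 * ((ρ : ℝ) + 2) ≤ 7 * ρ := by nlinarith
    linarith
  have hP1 : (1 : ℝ) ≤ P := by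
    have : (0 : ℝ) ≤ j := Nat.cast_nonneg j
    rw [hPdef]; linarith
  have hPC : P ^ C ≤ P ^ (C + 7) := Real.rpow_le_rpow_of_exponent_le hP1 (by linarith)
  have hsum0 : (0 : ℝ) ≤ (2 : ℝ) ^ (-(c * ρ)) + (2 : ℝ) ^ (C * ρ - c * i) +
      (2 : ℝ) ^ (C * ρ - c * (m : ℝ)) := by positivity
  calc |boxSum T i j α β| ≤ ∑ a ∈ dyBlock i, |∑ b ∈ dyBlock j, β b * natWalsh T (a * b)| :=
        abs_boxSum_le_sum_abs T i j α β hα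
    _ ≤ P ^ C * 2 ^ (i + j) *
        ((2 : ℝ) ^ (-(c * ρ)) + (2 : ℝ) ^ (C * ρ - c * i) + (2 : ℝ) ^ (C * ρ - c * (m : ℝ))) := hbest
    _ ≤ P ^ (C + 7) * 2 ^ (i + j) *
        ((2 : ℝ) ^ (-(c₁ / 2 * g₀)) + (2 : ℝ) ^ ((C + 7) * ρ - c₁ / 2 * i) +
          (2 : ℝ) ^ ((C + 7) * ρ - c₁ / 2 * (W : ℝ))) :=
        mul_le_mul (mul_le_mul_of_nonneg_right hPC (by positivity)) (add_le_add (add_le_add tA tB) tC)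
          hsum0 (by positivity)
    _ = 2 ^ (i + j) * P ^ (C + 7) *
        ((2 : ℝ) ^ (-(c₁ / 2 * g₀)) + (2 : ℝ) ^ ((C + 7) * ρ - c₁ / 2 * i) +
          (2 : ℝ) ^ ((C + 7) * ρ - c₁ / 2 * (W : ℝ))) := by ring

end Literature.NumberTheory.LFunctions.MoebiusWalshTypeII

/-! ### Discharge of the named fact for the Möbius function -/

namespace Literature.NumberTheory.LFunctions

/-- **Bourgain 2013, Theorem 1 (Möbius–Walsh) — PROVED** (discharge of the named fact
`bourgain_moebius_walsh_uniform` of `MoebiusWalshCircuits.lean`): for all sufficiently large `n` and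
every `A ⊆ {0,…,n-1}`, `|∑_{x<2ⁿ} μ(x) w_A(x)| < 2^{n - n^{1/10}}`. The tree's synthesis
`MoebiusWalsh.bourgain_moebius_walsh_uniform_of_typeII` (Green's Proposition 1 for small weights,
the Vaughan-type reduction, the type-I estimates of §3, the numerics of (3.10)) applied to the
per-box type-II estimate of §2 in the required shape (`MoebiusWalshTypeII.typeII_assemblyShape`,
from `MoebiusWalshTypeII.typeII_perBox`). [cite: Bourgain2013MoebiusWalsh, Theorem 1] -/
theorem bourgain_moebius_walsh_uniform_holds : bourgain_moebius_walsh_uniform :=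
  MoebiusWalsh.bourgain_moebius_walsh_uniform_of_typeII MoebiusWalshTypeII.typeII_assemblyShape

end Literature.NumberTheory.LFunctions

end
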